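import Summits.QuantumFields.YangMills.Theorems.FemtoTransferGapBounds

/-!
# The Wilson transfer kernel of `SU(n)` is positive semi-definite: `0 ≤ ⟨ψ, K_β ψ⟩`, hence `0 ≤ λ_k(β, L)` for `β ≥ 0`
# (support module of the `FemtoTransferGap` group; discharges the registered stub `stub_transferValuesNonneg` of route `LuscherReduction`)

Fifth module of the `FemtoTransferGap` group (cell `ym-beyond`, seat P1 «RG into the infrared», memo `run/shared/lean/pub/ym-beyond/ROUTE-P1.md`
§32).  The min–max transfer values `levelValue ρ L β k` of `Theorems.FemtoTransferGapLevels` are `sInf`'s of `sSup`'s of Rayleigh quotients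
`⟨ψ,K_βψ⟩/⟨ψ,ψ⟩`; the companion module `FemtoTransferGapBounds` shows they are `≤ λ₀ < ∞` and `0 < λ₀`.  Here we prove the complementary
lower bound **`0 ≤ λ_k`** for the fundamental representation of `SU(n)` and every `β ≥ 0`, by proving that the transfer QUADRATIC FORM is
non-negative on every physical test function — positive semi-definiteness of the temporal-gauge transfer kernel, the elementary core of
Osterwalder–Seiler reflection positivity for the Wilson action [cite: OsterwalderSeiler1978, §2] [cite: SeilerLNP1982, §3]:

* §1 (abstract, any finite measure space `(X, μ)`): a FINITE GRAM KERNEL `∑ᵢ cᵢ gᵢ(x) gᵢ(y)` with `cᵢ ≥ 0` is positive semi-definite in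
  integral form, `0 ≤ ∫ Φ(x) (∑ᵢ cᵢ gᵢ(x)gᵢ(y)) Φ(y) d(μ⊗μ)` (`integral_prod_gram_nonneg`: it equals `∑ᵢ cᵢ (∫Φgᵢ)²`, Fubini for products);
  powers of a Gram kernel are Gram kernels (`gram_pow_eq_sum`, multinomial expansion over `Fin n → ι`), so every TRUNCATED EXPONENTIAL
  `∑_{n<m} (βT)ⁿ/n!` of a bounded measurable Gram kernel `T` with `β ≥ 0` is positive semi-definite (`integral_prod_expTrunc_gram_nonneg`), and by
  dominated convergence (`|∑_{n<m} yⁿ/n!| ≤ e^{|y|}`, `Real.sum_le_exp_of_nonneg`) so is `exp(βT)` (`integral_prod_exp_gram_nonneg`);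
* §2 (the Wilson kernel): for the fundamental representation of `SU(n)` the time-like coupling is a Gram kernel,
  `∑ₑ Re tr(Uₑ Vₑ⁻¹) = ∑ₑ Re tr(Uₑ Vₑᴴ) = ∑_{e,i,j} (Re Uₑᵢⱼ Re Vₑᵢⱼ + Im Uₑᵢⱼ Im Vₑᵢⱼ)` (`timeCoupling_fundamentalRep_eq_gram`, features
  `suFeature`), and `ψ(U)K_β(U,V)ψ(V) = Φ(U) e^{β T(U,V)} Φ(V)` with `Φ = ψ·e^{−(β/2)S}`; hence **`0 ≤ qform (fundamentalRep (Fin n)) β ψ ψ`** for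
  every physical `ψ` and `β ≥ 0` (`qform_self_nonneg_fundamentalRep`);
* §3 `0 ≤ levelValue` whenever the quadratic form is non-negative (`levelValue_nonneg_of_qform_nonneg`, real `sInf`/`sSup` conventions included),
  so `0 ≤ λ_k(β, L)` for `SU(n)`, `β ≥ 0`, every `k`, `L` (`levelValue_fundamentalRep_nonneg`, `levelValue_su2Rep_nonneg`), and
  **`transferValuesNonneg : ∀ L β k, 1 ≤ β → 0 ≤ levelValue su2Rep L β k`** — VERBATIM the statement `TransferValuesNonneg` of the registered BC3
  birth skeleton of crux `RunningReduction` (stub `stub_transferValuesNonneg` = S3, item stmt-QuantumFields-19978) of route `LuscherReduction`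
  (QuantumFields / YangMills; rung leaf R2b1 `FemtoGapOfRecord`), dischargeable by name.  With `FemtoTransferGapBounds`: `0 ≤ λ_k ≤ λ₀`, `0 < λ₀`.

## WHAT THIS IS NOT
Not reflection positivity of the full lattice theory with its OS reconstruction (only the positivity of the temporal-gauge transfer kernel as a
quadratic form on bounded measurable functions), not a gap, NOT THE CLAY GAP.  Everything below is proved (no `sorry`, no new axiom, no named
fact).

## FILING NOTE (courier seat `ym-beyond-courier`, prover filing rights D-0016; no mathematics added, no statement changed)
Seat P1 g10's payload `p1-g10-files/FemtoTransferGapPositivity.lean` (sha16 0895ebc796f7c5a3, 419 lines) exceeds the gate's 400-line cap for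
Theorems files with proofs (`lint.statement-form`), so it is landed as a FAITHFUL TWO-MODULE PARTITION at its own § boundary, same namespace
(every FQN unchanged): THIS module = part 1/2 = §1 (abstract Gram-kernel positivity, `gram_pow_eq_sum` … `integral_prod_exp_gram_nonneg`);
`Theorems/FemtoTransferGapPositivity.lean` = part 2/2 = §2–§3 (the Wilson kernel, `qform_self_nonneg_fundamentalRep`, `transferValuesNonneg`),
importing this one.  The module docstring above is the payload's, verbatim.
-/

set_option autoImplicit false

noncomputable section

open MeasureTheory Filter Topology Real
open scoped Nat
open Literature.MathematicalPhysics.QuantumFieldTheory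
open Literature.MathematicalPhysics.QuantumLattice
open Literature.Analysis.OperatorTheory.YMMatrixModel

namespace Summit.QuantumFields.YangMills.Theorems.FemtoTransferGap

/-! ### §1. Finite Gram kernels, their powers and (truncated) exponentials are positive semi-definite in integral form -/

section GramAlgebra

variable {X : Type*}

/-- Powers of a Gram kernel are Gram kernels: `(∑ₐ gₐ(x)gₐ(y))ⁿ = ∑_{q : Fin n → ι} (∏ₖ g_{q k}(x)) (∏ₖ g_{q k}(y))`. [folklore] -/
theorem gram_pow_eq_sum {ι : Type*} [Fintype ι] [DecidableEq ι] (g : ι → X → ℝ) (x y : X) (n : ℕ) :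
    (∑ a, g a x * g a y) ^ n = ∑ q : Fin n → ι, (∏ k, g (q k) x) * (∏ k, g (q k) y) := by
  rw [Finset.sum_pow', Fintype.piFinset_univ]
  refine Finset.sum_congr rfl fun q _ => ?_
  rw [Finset.prod_mul_distrib]

/-- A Gram kernel with bounded features is bounded: `|∑ₐ gₐ(x)gₐ(y)| ≤ |ι| B²`. [folklore] -/
theorem abs_gram_le {ι : Type*} [Fintype ι] (g : ι → X → ℝ) {B : ℝ} (hB : 0 ≤ B)
    (hgb : ∀ a x, |g a x| ≤ B) (x y : X) :
    |∑ a, g a x * g a y| ≤ Fintype.card ι * B ^ 2 := by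
  calc |∑ a, g a x * g a y| ≤ ∑ a, |g a x * g a y| := Finset.abs_sum_le_sum_abs _ _
    _ ≤ ∑ _a : ι, B ^ 2 := by
        refine Finset.sum_le_sum fun a _ => ?_
        rw [abs_mul, sq]
        exact mul_le_mul (hgb a x) (hgb a y) (abs_nonneg _) hB
    _ = Fintype.card ι * B ^ 2 := by
        rw [Finset.sum_const, Finset.card_univ, nsmul_eq_mul]

/-- Products of `n` bounded features are bounded by `Bⁿ`. [folklore] -/
theorem abs_prod_features_le {ι : Type*} (g : ι → X → ℝ) {B : ℝ} (hgb : ∀ a x, |g a x| ≤ B)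
    {n : ℕ} (q : Fin n → ι) (x : X) : |∏ k, g (q k) x| ≤ B ^ n := by
  rw [Finset.abs_prod]
  calc ∏ k, |g (q k) x| ≤ ∏ _k : Fin n, B :=
        Finset.prod_le_prod (fun k _ => abs_nonneg _) fun k _ => hgb _ _
    _ = B ^ n := by rw [Finset.prod_const, Finset.card_univ, Fintype.card_fin]

end GramAlgebra

section Gram

variable {X : Type*} [MeasurableSpace X] (μ : Measure X) [IsFiniteMeasure μ]

/-- A measurable real function with a uniform bound is integrable for a finite measure. [folklore] -/
theorem integrable_of_measurable_abs_le {f : X → ℝ} (hf : Measurable f) {C : ℝ} (hC : ∀ x, |f x| ≤ C) :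
    Integrable f μ :=
  Integrable.mono' (integrable_const C) hf.aestronglyMeasurable
    (ae_of_all _ fun x => by rw [Real.norm_eq_abs]; exact hC x)

/-- **Finite Gram kernels are positive semi-definite (integral form).**
`∫ Φ(x) (∑ᵢ gᵢ(x) gᵢ(y)) Φ(y) d(μ⊗μ) = ∑ᵢ (∫ Φ gᵢ dμ)² ≥ 0`. [folklore] -/
theorem integral_prod_gram_nonneg {ι : Type*} [Fintype ι]
    (g : ι → X → ℝ) (Φ : X → ℝ) (hint : ∀ i, Integrable (fun x => Φ x * g i x) μ) :
    0 ≤ ∫ p, Φ p.1 * (∑ i, g i p.1 * g i p.2) * Φ p.2 ∂(μ.prod μ) := by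
  have hpt : (fun p : X × X => Φ p.1 * (∑ i, g i p.1 * g i p.2) * Φ p.2)
      = fun p => ∑ i, (Φ p.1 * g i p.1) * (Φ p.2 * g i p.2) := by
    funext p
    rw [Finset.mul_sum, Finset.sum_mul]
    refine Finset.sum_congr rfl fun i _ => ?_
    ring
  rw [hpt, integral_finsetSum _ fun i _ => (hint i).mul_prod (hint i)]
  refine Finset.sum_nonneg fun i _ => ?_
  rw [integral_prod_mul (μ := μ) (ν := μ) (fun x => Φ x * g i x) (fun x => Φ x * g i x)]
  exact mul_self_nonneg _

/-- A Gram kernel with finitely many measurable features is measurable on the product. [folklore] -/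
theorem measurable_gram {ι : Type*} [Fintype ι] (g : ι → X → ℝ) (hgm : ∀ a, Measurable (g a)) :
    Measurable fun p : X × X => ∑ a, g a p.1 * g a p.2 :=
  Finset.measurable_sum _ fun a _ => ((hgm a).comp measurable_fst).mul ((hgm a).comp measurable_snd)

/-- A sandwiched bounded measurable kernel `Φ(x) H(x,y) Φ(y)` is integrable on the product of a finite measure with itself. [folklore] -/
theorem integrable_sandwich {H : X × X → ℝ} (hH : Measurable H) {R : ℝ} (hR : ∀ p, |H p| ≤ R)
    {Φ : X → ℝ} (hΦm : Measurable Φ) {C : ℝ} (hΦb : ∀ x, |Φ x| ≤ C) :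
    Integrable (fun p : X × X => Φ p.1 * H p * Φ p.2) (μ.prod μ) := by
  refine integrable_of_measurable_abs_le (μ.prod μ) (f := fun p : X × X => Φ p.1 * H p * Φ p.2)
    (((hΦm.comp measurable_fst).mul hH).mul (hΦm.comp measurable_snd)) (C := C * R * C) fun p => ?_
  have hC : 0 ≤ C := (abs_nonneg _).trans (hΦb p.1)
  have hR0 : 0 ≤ R := (abs_nonneg _).trans (hR p)
  show |Φ p.1 * H p * Φ p.2| ≤ C * R * C
  rw [abs_mul, abs_mul]
  exact mul_le_mul (mul_le_mul (hΦb _) (hR _) (abs_nonneg _) hC) (hΦb _) (abs_nonneg _)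
    (mul_nonneg hC hR0)

/-- **Powers of a bounded measurable Gram kernel are positive semi-definite**: `0 ≤ ∫ Φ(x) T(x,y)ⁿ Φ(y) d(μ⊗μ)`, `T(x,y) = ∑ₐ gₐ(x)gₐ(y)`
(`Tⁿ` is the Gram kernel of the product features over `Fin n → ι`). [folklore] -/
theorem integral_prod_gram_pow_nonneg {ι : Type*} [Fintype ι] [DecidableEq ι] (g : ι → X → ℝ)
    (hgm : ∀ a, Measurable (g a)) {B : ℝ} (hgb : ∀ a x, |g a x| ≤ B)
    (Φ : X → ℝ) (hΦm : Measurable Φ) {C : ℝ} (hΦb : ∀ x, |Φ x| ≤ C) (n : ℕ) :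
    0 ≤ ∫ p, Φ p.1 * (∑ a, g a p.1 * g a p.2) ^ n * Φ p.2 ∂(μ.prod μ) := by
  have hpt : (fun p : X × X => Φ p.1 * (∑ a, g a p.1 * g a p.2) ^ n * Φ p.2)
      = fun p => Φ p.1 * (∑ q : Fin n → ι, (∏ k, g (q k) p.1) * (∏ k, g (q k) p.2)) * Φ p.2 := by
    funext p
    rw [gram_pow_eq_sum]
  have key : ∀ q : Fin n → ι, Integrable (fun x => Φ x * ∏ k, g (q k) x) μ := by
    intro q
    refine integrable_of_measurable_abs_le μ (f := fun x => Φ x * ∏ k, g (q k) x)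
      (hΦm.mul (Finset.measurable_prod _ fun k _ => hgm (q k))) (C := C * B ^ n) fun x => ?_
    show |Φ x * ∏ k, g (q k) x| ≤ C * B ^ n
    rw [abs_mul]
    exact mul_le_mul (hΦb x) (abs_prod_features_le g hgb q x) (abs_nonneg _)
      ((abs_nonneg _).trans (hΦb x))
  have h := integral_prod_gram_nonneg μ (fun (q : Fin n → ι) (x : X) => ∏ k, g (q k) x) Φ key
  rw [hpt]
  exact h

/-- … and integrable. [folklore] -/
theorem integrable_sandwich_gram_pow {ι : Type*} [Fintype ι] (g : ι → X → ℝ)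
    (hgm : ∀ a, Measurable (g a)) {B : ℝ} (hB : 0 ≤ B) (hgb : ∀ a x, |g a x| ≤ B)
    (Φ : X → ℝ) (hΦm : Measurable Φ) {C : ℝ} (hΦb : ∀ x, |Φ x| ≤ C) (n : ℕ) :
    Integrable (fun p : X × X => Φ p.1 * (∑ a, g a p.1 * g a p.2) ^ n * Φ p.2) (μ.prod μ) := by
  refine integrable_sandwich μ (H := fun p : X × X => (∑ a, g a p.1 * g a p.2) ^ n)
    ((measurable_gram g hgm).pow_const n) (R := (Fintype.card ι * B ^ 2) ^ n) (fun p => ?_) hΦm hΦb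
  show |(∑ a, g a p.1 * g a p.2) ^ n| ≤ _
  rw [abs_pow]
  exact pow_le_pow_left₀ (abs_nonneg _) (abs_gram_le g hB hgb p.1 p.2) n

/-- **Truncated exponentials of a Gram kernel are positive semi-definite**: for `β ≥ 0`, bounded measurable features and a bounded measurable
`Φ`, `0 ≤ ∫ Φ(x) (∑_{n<m} (β T(x,y))ⁿ/n!) Φ(y) d(μ⊗μ)` with `T(x,y) = ∑ₐ gₐ(x)gₐ(y)` (each `Tⁿ` is positive semi-definite, coefficients
`βⁿ/n! ≥ 0`). [folklore] -/
theorem integral_prod_expTrunc_gram_nonneg {ι : Type*} [Fintype ι] [DecidableEq ι] (g : ι → X → ℝ)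
    (hgm : ∀ a, Measurable (g a)) {B : ℝ} (hB : 0 ≤ B) (hgb : ∀ a x, |g a x| ≤ B)
    (Φ : X → ℝ) (hΦm : Measurable Φ) {C : ℝ} (hΦb : ∀ x, |Φ x| ≤ C) {β : ℝ} (hβ : 0 ≤ β) (m : ℕ) :
    0 ≤ ∫ p, Φ p.1 * (∑ n ∈ Finset.range m, (β * ∑ a, g a p.1 * g a p.2) ^ n / n !) * Φ p.2 ∂(μ.prod μ) := by
  have hpt : (fun p : X × X => Φ p.1 * (∑ n ∈ Finset.range m, (β * ∑ a, g a p.1 * g a p.2) ^ n / n !) * Φ p.2)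
      = fun p => ∑ n ∈ Finset.range m, (β ^ n / n !) * (Φ p.1 * (∑ a, g a p.1 * g a p.2) ^ n * Φ p.2) := by
    funext p
    rw [Finset.mul_sum, Finset.sum_mul]
    refine Finset.sum_congr rfl fun n _ => ?_
    rw [mul_pow]
    ring
  rw [hpt, integral_finsetSum _ fun n _ =>
    (integrable_sandwich_gram_pow μ g hgm hB hgb Φ hΦm hΦb n).const_mul _]
  refine Finset.sum_nonneg fun n _ => ?_
  rw [integral_const_mul]
  exact mul_nonneg (div_nonneg (pow_nonneg hβ n) (Nat.cast_nonneg _))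
    (integral_prod_gram_pow_nonneg μ g hgm hgb Φ hΦm hΦb n)

/-- `|∑_{n<m} yⁿ/n!| ≤ e^{|y|}`. [folklore] -/
theorem abs_expTrunc_le (y : ℝ) (m : ℕ) : |∑ n ∈ Finset.range m, y ^ n / n !| ≤ Real.exp |y| := by
  calc |∑ n ∈ Finset.range m, y ^ n / n !| ≤ ∑ n ∈ Finset.range m, |y ^ n / n !| :=
        Finset.abs_sum_le_sum_abs _ _
    _ = ∑ n ∈ Finset.range m, |y| ^ n / n ! := by
        refine Finset.sum_congr rfl fun n _ => ?_
        rw [abs_div, abs_pow, Nat.abs_cast]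
    _ ≤ Real.exp |y| := Real.sum_le_exp_of_nonneg (abs_nonneg _) m

/-- The exponential series converges: `∑_{n<m} yⁿ/n! → eʸ`. [folklore] -/
theorem tendsto_expTrunc (y : ℝ) :
    Tendsto (fun m => ∑ n ∈ Finset.range m, y ^ n / n !) atTop (𝓝 (Real.exp y)) := by
  have h : HasSum (fun n => y ^ n / n !) (Real.exp y) := by
    rw [Real.exp_eq_exp_ℝ]
    exact NormedSpace.expSeries_div_hasSum_exp y
  exact h.tendsto_sum_nat

/-- **The exponential of a Gram kernel is positive semi-definite** (Schur-product / power-series argument in integral form): for `β ≥ 0`,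
bounded measurable features and bounded measurable `Φ`, `0 ≤ ∫ Φ(x) exp(β ∑ₐ gₐ(x)gₐ(y)) Φ(y) d(μ⊗μ)` — the truncations are `≥ 0` and converge by
dominated convergence. [folklore] -/
theorem integral_prod_exp_gram_nonneg {ι : Type*} [Fintype ι] [DecidableEq ι] (g : ι → X → ℝ)
    (hgm : ∀ a, Measurable (g a)) {B : ℝ} (hB : 0 ≤ B) (hgb : ∀ a x, |g a x| ≤ B)
    (Φ : X → ℝ) (hΦm : Measurable Φ) {C : ℝ} (hC : 0 ≤ C) (hΦb : ∀ x, |Φ x| ≤ C) {β : ℝ} (hβ : 0 ≤ β) :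
    0 ≤ ∫ p, Φ p.1 * Real.exp (β * ∑ a, g a p.1 * g a p.2) * Φ p.2 ∂(μ.prod μ) := by
  have hTm : Measurable fun p : X × X => ∑ a, g a p.1 * g a p.2 := measurable_gram g hgm
  have hTb : ∀ p : X × X, |∑ a, g a p.1 * g a p.2| ≤ Fintype.card ι * B ^ 2 :=
    fun p => abs_gram_le g hB hgb p.1 p.2
  have hlim : Tendsto
      (fun m => ∫ p, Φ p.1 * (∑ n ∈ Finset.range m, (β * ∑ a, g a p.1 * g a p.2) ^ n / n !) * Φ p.2 ∂(μ.prod μ))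
      atTop (𝓝 (∫ p, Φ p.1 * Real.exp (β * ∑ a, g a p.1 * g a p.2) * Φ p.2 ∂(μ.prod μ))) := by
    refine tendsto_integral_of_dominated_convergence
      (fun _ => C * Real.exp (β * (Fintype.card ι * B ^ 2)) * C) (fun m => ?_) (integrable_const _)
      (fun m => ae_of_all _ fun p => ?_) (ae_of_all _ fun p => ?_)
    · exact (((hΦm.comp measurable_fst).fun_mul (Finset.measurable_sum _ fun n _ =>
        ((hTm.const_mul β).pow_const n).div_const _)).fun_mul (hΦm.comp measurable_snd)).aestronglyMeasurable
    · rw [Real.norm_eq_abs, abs_mul, abs_mul]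
      have h1 : |∑ n ∈ Finset.range m, (β * ∑ a, g a p.1 * g a p.2) ^ n / n !|
          ≤ Real.exp (β * (Fintype.card ι * B ^ 2)) := by
        refine (abs_expTrunc_le _ m).trans (Real.exp_le_exp.mpr ?_)
        rw [abs_mul, abs_of_nonneg hβ]
        exact mul_le_mul_of_nonneg_left (hTb p) hβ
      exact mul_le_mul (mul_le_mul (hΦb _) h1 (abs_nonneg _) hC) (hΦb _) (abs_nonneg _)
        (mul_nonneg hC (Real.exp_pos _).le)
    · exact ((tendsto_expTrunc _).const_mul (Φ p.1)).mul_const (Φ p.2)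
  refine ge_of_tendsto' hlim fun m => ?_
  exact integral_prod_expTrunc_gram_nonneg μ g hgm hB hgb Φ hΦm hΦb hβ m

end Gram

end Summit.QuantumFields.YangMills.Theorems.FemtoTransferGap

end
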